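import Literature.Analysis.OperatorTheory.YangMillsMatrixModelEnergyBilinear
import Literature.Analysis.OperatorTheory.YangMillsMatrixModelRadialCutoff
import Mathlib.Analysis.InnerProductSpace.PiL2
import Mathlib.LinearAlgebra.UnitaryGroup
import HarnessLib

/-!
# Colour rotations of the `SU(2)` matrix-model configuration space: linear isometries commuting with `𝔥`

Topic `Literature/Analysis/OperatorTheory`; calculus of the diagonal colour action
`colourRotate M : x_i ↦ M x_i` (`M ∈ O(3)`) on `ℝ⁹ = (ℝ³)³` (`YangMillsMatrixModelDiscreteSpectrum.lean`),
the symmetry group of Lüscher's effective Hamiltonian `𝔥 = −½Δ + ¼Σ|x_i × x_j|²` whose `SO(3)`-invariant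
sector carries the min–max levels `physLevel`.

* `colourRotateL M : ZM →L[ℝ] ZM` — `colourRotate M` as a continuous linear map; `colourRotate_mul`
  (`M (N x) = (MN) x`); for ORTHOGONAL `M` (`M ∈ Matrix.orthogonalGroup (Fin 3) ℝ`): `dot_colourRotate`
  (`(Mx_i)·(Mx_j) = x_i·x_j`), `norm_colourRotate_of_mem_orthogonalGroup`, the inverse relations
  `colourRotate_transpose_colourRotate` / `colourRotate_colourRotate_transpose`, and the packaging
  `colourRotateLIE hM : ZM ≃ₗᵢ[ℝ] ZM`;
* ★ `luscherPotential_colourRotate` — `V(M·x) = V(x)` for `M ∈ O(3)` (Lagrange's identity);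
* ★ `laplacian_comp_colourRotate` — `Δ(φ ∘ M·)(x) = (Δφ)(M·x)` for `φ ∈ C²` (chain rule + independence
  of the trace `Σ_p D²φ(y)(f_p, f_p)` of the orthonormal basis `f`, `sum_bilin_orthonormalBasis_eq`);
  hence ★ `hApply_comp_colourRotate` — **`𝔥(φ ∘ M·) = (𝔥φ) ∘ M·`: the Hamiltonian commutes with colour
  rotations**; and `isTestFn_comp_colourRotate` (the core `C²_c` is stable).

These are the symmetry facts used (i) to average test functions over `SO(3)` and (ii) to transport the weak
eigen-equation from invariant to arbitrary test functions (Reed–Simon IV §XIII.12, Cor. of Thm XIII.46: a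
symmetry commuting with `H`; van Baal 2001 §4: the residual gauge group `SO(3)` of the zero-mode problem).
One definition with body (`colourRotateL`; `colourRotateLIE`), no named facts, no instances.

## References
* [Vanbaal2001] P. van Baal, *QCD in a finite volume*, hep-ph/0008206, §4 (zero modes, residual `SO(3)`).
* [ReedSimonIV1978] M. Reed, B. Simon, *Methods of Modern Mathematical Physics IV*, §XIII.12
  (Cor. of Thm XIII.46: symmetries commuting with the Hamiltonian).
-/

noncomputable section

open MeasureTheory Filter Matrix
open scoped BigOperators RealInnerProductSpace

namespace Literature.Analysis.OperatorTheory.YMMatrixModel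

/-! ### 1. Linearity, multiplicativity -/

/-- Coordinates of a colour rotation: `(M·x)_{(i,a)} = Σ_b M_{ab} x_{(i,b)}`. [cite: Vanbaal2001, §4] -/
theorem colourRotate_apply (M : Matrix (Fin 3) (Fin 3) ℝ) (x : ZM) (p : Fin 3 × Fin 3) :
    colourRotate M x p = ∑ b, M p.2 b * x (p.1, b) := rfl

/-- Colour rotation is additive in the configuration. [cite: Vanbaal2001, §4] -/
theorem colourRotate_add (M : Matrix (Fin 3) (Fin 3) ℝ) (x y : ZM) :
    colourRotate M (x + y) = colourRotate M x + colourRotate M y := by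
  ext p
  simp [colourRotate_apply, mul_add, Finset.sum_add_distrib]

/-- **`colourRotate M` as a continuous linear map of `ℝ⁹`.** [cite: Vanbaal2001, §4] -/
def colourRotateL (M : Matrix (Fin 3) (Fin 3) ℝ) : ZM →L[ℝ] ZM :=
  LinearMap.toContinuousLinearMap
    { toFun := colourRotate M
      map_add' := colourRotate_add M
      map_smul' := fun c x => colourRotate_smul M c x }

/-- `colourRotateL M x = colourRotate M x`. [cite: Vanbaal2001, §4] -/
@[simp] theorem colourRotateL_apply (M : Matrix (Fin 3) (Fin 3) ℝ) (x : ZM) :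
    colourRotateL M x = colourRotate M x := rfl

/-- `colourRotate` is continuous. [cite: Vanbaal2001, §4] -/
theorem continuous_colourRotate (M : Matrix (Fin 3) (Fin 3) ℝ) : Continuous (colourRotate M) :=
  (colourRotateL M).continuous

/-- **Multiplicativity**: `M·(N·x) = (MN)·x`. [cite: Vanbaal2001, §4] -/
theorem colourRotate_mul (M N : Matrix (Fin 3) (Fin 3) ℝ) (x : ZM) :
    colourRotate M (colourRotate N x) = colourRotate (M * N) x := by
  ext p
  simp only [colourRotate_apply, Matrix.mul_apply, Finset.sum_mul, Finset.mul_sum]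
  rw [Finset.sum_comm]
  exact Finset.sum_congr rfl fun b _ => Finset.sum_congr rfl fun c _ => by ring

/-! ### 2. Orthogonal colour rotations are isometries -/

section Orthogonal

variable {M : Matrix (Fin 3) (Fin 3) ℝ}

/-- For `M ∈ O(3)`: `Σ_a M_{ab} M_{ac} = δ_{bc}` (`Mᵀ M = 1`). [cite: Vanbaal2001, §4] -/
theorem sum_mul_eq_ite_of_mem_orthogonalGroup (hM : M ∈ Matrix.orthogonalGroup (Fin 3) ℝ) (b c : Fin 3) :
    ∑ a, M a b * M a c = if b = c then 1 else 0 := by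
  have h1 : star M * M = 1 := Matrix.mem_unitaryGroup_iff'.1 hM
  have h2 := congrFun (congrFun h1 b) c
  rw [Matrix.mul_apply, Matrix.one_apply] at h2
  simpa [Matrix.star_apply] using h2

/-- For `M ∈ O(3)`: `Σ_b M_{ab} M_{cb} = δ_{ac}` (`M Mᵀ = 1`). [cite: Vanbaal2001, §4] -/
theorem sum_mul_eq_ite_of_mem_orthogonalGroup' (hM : M ∈ Matrix.orthogonalGroup (Fin 3) ℝ) (a c : Fin 3) :
    ∑ b, M a b * M c b = if a = c then 1 else 0 := by
  have h1 : M * star M = 1 := Matrix.mem_unitaryGroup_iff.1 hM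
  have h2 := congrFun (congrFun h1 a) c
  rw [Matrix.mul_apply, Matrix.one_apply] at h2
  simpa [Matrix.star_apply] using h2

/-- The transpose of an orthogonal matrix is orthogonal. [cite: Vanbaal2001, §4] -/
theorem transpose_mem_orthogonalGroup (hM : M ∈ Matrix.orthogonalGroup (Fin 3) ℝ) :
    Mᵀ ∈ Matrix.orthogonalGroup (Fin 3) ℝ := by
  rw [Matrix.mem_orthogonalGroup_iff, Matrix.transpose_transpose]
  exact (Matrix.mem_orthogonalGroup_iff' (Fin 3) ℝ).1 hM

/-- **Orthogonal colour rotations preserve the colour dot products**: `(M x_i)·(M x_j) = x_i·x_j`.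
[cite: Vanbaal2001, §4] -/
theorem dot_colourRotate (hM : M ∈ Matrix.orthogonalGroup (Fin 3) ℝ) (x y : ZM) (i j : Fin 3) :
    colourVec (colourRotate M x) i ⬝ᵥ colourVec (colourRotate M y) j = colourVec x i ⬝ᵥ colourVec y j := by
  simp only [dotProduct, colourVec, colourRotate_apply]
  calc ∑ a, (∑ b, M a b * x (i, b)) * (∑ c, M a c * y (j, c))
      = ∑ a, ∑ b, ∑ c, M a b * x (i, b) * (M a c * y (j, c)) := by
        refine Finset.sum_congr rfl fun a _ => ?_
        rw [Finset.sum_mul_sum]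
    _ = ∑ b, ∑ c, ∑ a, M a b * x (i, b) * (M a c * y (j, c)) := by
        rw [Finset.sum_comm]
        refine Finset.sum_congr rfl fun b _ => ?_
        rw [Finset.sum_comm]
    _ = ∑ b, ∑ c, (if b = c then 1 else 0) * (x (i, b) * y (j, c)) := by
        refine Finset.sum_congr rfl fun b _ => Finset.sum_congr rfl fun c _ => ?_
        rw [← sum_mul_eq_ite_of_mem_orthogonalGroup hM b c, Finset.sum_mul]
        exact Finset.sum_congr rfl fun a _ => by ring
    _ = ∑ b, x (i, b) * y (j, b) := by
        refine Finset.sum_congr rfl fun b _ => ?_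
        simp [ite_mul, Finset.sum_ite_eq]

/-- Orthogonal colour rotations preserve the inner product of `ℝ⁹`. [cite: Vanbaal2001, §4] -/
theorem inner_colourRotate (hM : M ∈ Matrix.orthogonalGroup (Fin 3) ℝ) (x y : ZM) :
    ⟪colourRotate M x, colourRotate M y⟫ = ⟪x, y⟫ := by
  have h : ∀ u v : ZM, ⟪u, v⟫ = ∑ i, colourVec u i ⬝ᵥ colourVec v i := by
    intro u v
    rw [PiLp.inner_apply, Fintype.sum_prod_type]
    refine Finset.sum_congr rfl fun i _ => ?_
    simp only [dotProduct, colourVec, RCLike.inner_apply, conj_trivial]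
    exact Finset.sum_congr rfl fun a _ => mul_comm _ _
  rw [h, h]
  exact Finset.sum_congr rfl fun i _ => dot_colourRotate hM x y i i

/-- **Orthogonal colour rotations are isometries of `ℝ⁹`.** [cite: Vanbaal2001, §4] -/
theorem norm_colourRotate_of_mem_orthogonalGroup (hM : M ∈ Matrix.orthogonalGroup (Fin 3) ℝ) (x : ZM) :
    ‖colourRotate M x‖ = ‖x‖ := by
  rw [norm_eq_sqrt_real_inner, norm_eq_sqrt_real_inner, inner_colourRotate hM]

/-- `Mᵀ·(M·x) = x` for `M ∈ O(3)`. [cite: Vanbaal2001, §4] -/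
theorem colourRotate_transpose_colourRotate (hM : M ∈ Matrix.orthogonalGroup (Fin 3) ℝ) (x : ZM) :
    colourRotate Mᵀ (colourRotate M x) = x := by
  rw [colourRotate_mul, show Mᵀ * M = 1 from (Matrix.mem_orthogonalGroup_iff' (Fin 3) ℝ).1 hM, colourRotate_one]

/-- `M·(Mᵀ·x) = x` for `M ∈ O(3)`. [cite: Vanbaal2001, §4] -/
theorem colourRotate_colourRotate_transpose (hM : M ∈ Matrix.orthogonalGroup (Fin 3) ℝ) (x : ZM) :
    colourRotate M (colourRotate Mᵀ x) = x := by
  rw [colourRotate_mul, show M * Mᵀ = 1 from (Matrix.mem_orthogonalGroup_iff (Fin 3) ℝ).1 hM, colourRotate_one]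

/-- **`colourRotate M`, `M ∈ O(3)`, as a linear isometric automorphism of `ℝ⁹`** (inverse `colourRotate Mᵀ`).
[cite: Vanbaal2001, §4] -/
def colourRotateLIE (hM : M ∈ Matrix.orthogonalGroup (Fin 3) ℝ) : ZM ≃ₗᵢ[ℝ] ZM :=
  LinearIsometryEquiv.mk
    { toFun := colourRotate M
      map_add' := colourRotate_add M
      map_smul' := fun c x => colourRotate_smul M c x
      invFun := colourRotate Mᵀ
      left_inv := colourRotate_transpose_colourRotate hM
      right_inv := colourRotate_colourRotate_transpose hM }
    (norm_colourRotate_of_mem_orthogonalGroup hM)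

/-- `colourRotateLIE hM x = colourRotate M x`. [cite: Vanbaal2001, §4] -/
@[simp] theorem colourRotateLIE_apply (hM : M ∈ Matrix.orthogonalGroup (Fin 3) ℝ) (x : ZM) :
    colourRotateLIE hM x = colourRotate M x := rfl

/-- `(colourRotateLIE hM).symm x = colourRotate Mᵀ x`. [cite: Vanbaal2001, §4] -/
@[simp] theorem colourRotateLIE_symm_apply (hM : M ∈ Matrix.orthogonalGroup (Fin 3) ℝ) (x : ZM) :
    (colourRotateLIE hM).symm x = colourRotate Mᵀ x := rfl

/-- Orthogonal colour rotations preserve Lebesgue measure on `ℝ⁹`. [cite: ReedSimonIV1978, §XIII.12 Cor. of Thm. XIII.46] -/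
theorem measurePreserving_colourRotate (hM : M ∈ Matrix.orthogonalGroup (Fin 3) ℝ) :
    MeasurePreserving (colourRotate M) volume volume :=
  (colourRotateLIE hM).measurePreserving

/-- ★ **The potential is invariant under all of `O(3)`**: `V(M·x) = V(x)` (Lagrange's identity
`|u × v|² = |u|²|v|² − (u·v)²` and the invariance of the colour dot products). [cite: Vanbaal2001, §4] -/
theorem luscherPotential_colourRotate (hM : M ∈ Matrix.orthogonalGroup (Fin 3) ℝ) (x : ZM) :
    luscherPotential (colourRotate M x) = luscherPotential x := by
  simp only [luscherPotential, cross_dot_cross, dot_colourRotate hM]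

end Orthogonal

/-! ### 3. The trace of a bilinear form does not depend on the orthonormal basis -/

/-- For a continuous bilinear form `β` on a finite-dimensional real inner product space and two orthonormal
bases `b, b'`: `Σ_i β(b_i, b_i) = Σ_i β(b'_i, b'_i)` (both equal the trace of the operator representing
`β`; proof by expanding `b'_i = Σ_j ⟪b_j, b'_i⟫ b_j` and `Σ_i ⟪b_j, b'_i⟫⟪b'_i, b_k⟫ = ⟪b_j, b_k⟫`).
[cite: ReedSimonIV1978, Thm. XIII.2] -/
theorem sum_bilin_orthonormalBasis_eq {F : Type*} [NormedAddCommGroup F] [InnerProductSpace ℝ F]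
    {ι : Type*} [Fintype ι] [DecidableEq ι] (β : F →L[ℝ] F →L[ℝ] ℝ) (b b' : OrthonormalBasis ι ℝ F) :
    ∑ i, β (b i) (b i) = ∑ i, β (b' i) (b' i) := by
  have hsec : ∀ (v : F) (i : ι), β v (b' i) = ∑ k, ⟪b k, b' i⟫ * β v (b k) := fun v i => by
    calc β v (b' i) = β v (∑ k, ⟪b k, b' i⟫ • b k) := by rw [b.sum_repr' (b' i)]
      _ = ∑ k, ⟪b k, b' i⟫ * β v (b k) := by simp only [map_sum, map_smul, smul_eq_mul]
  have hfst : ∀ (w : F) (i : ι), β (b' i) w = ∑ j, ⟪b j, b' i⟫ * β (b j) w := fun w i => by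
    calc β (b' i) w = β (∑ j, ⟪b j, b' i⟫ • b j) w := by rw [b.sum_repr' (b' i)]
      _ = ∑ j, ⟪b j, b' i⟫ * β (b j) w := by
          simp only [map_sum, map_smul, FunLike.coe_sum, FunLike.coe_smul,
            Finset.sum_apply, Pi.smul_apply, smul_eq_mul]
  have hexp : ∀ i, β (b' i) (b' i) = ∑ j, ∑ k, ⟪b j, b' i⟫ * ⟪b k, b' i⟫ * β (b j) (b k) := by
    intro i
    rw [hfst]
    refine Finset.sum_congr rfl fun j _ => ?_
    rw [hsec, Finset.mul_sum]
    exact Finset.sum_congr rfl fun k _ => by ring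
  have horth : ∀ j k, ∑ i, ⟪b j, b' i⟫ * ⟪b k, b' i⟫ = if j = k then 1 else 0 := by
    intro j k
    have h1 : ∑ i, ⟪b j, b' i⟫ * ⟪b k, b' i⟫ = ∑ i, ⟪b j, b' i⟫ * ⟪b' i, b k⟫ :=
      Finset.sum_congr rfl fun i _ => by rw [real_inner_comm (b k)]
    rw [h1, b'.sum_inner_mul_inner]
    exact orthonormal_iff_ite.1 b.orthonormal j k
  calc ∑ i, β (b i) (b i) = ∑ j, ∑ k, (if j = k then 1 else 0) * β (b j) (b k) := by
        refine Finset.sum_congr rfl fun j _ => ?_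
        rw [Finset.sum_eq_single j (fun k _ hkj => by rw [if_neg (Ne.symm hkj), zero_mul])
          (fun hj => absurd (Finset.mem_univ j) hj), if_pos rfl, one_mul]
    _ = ∑ j, ∑ k, (∑ i, ⟪b j, b' i⟫ * ⟪b k, b' i⟫) * β (b j) (b k) := by
        simp only [horth]
    _ = ∑ j, ∑ i, ∑ k, ⟪b j, b' i⟫ * ⟪b k, b' i⟫ * β (b j) (b k) := by
        refine Finset.sum_congr rfl fun j _ => ?_
        simp only [Finset.sum_mul]
        rw [Finset.sum_comm]
    _ = ∑ i, ∑ j, ∑ k, ⟪b j, b' i⟫ * ⟪b k, b' i⟫ * β (b j) (b k) := Finset.sum_comm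
    _ = ∑ i, β (b' i) (b' i) := Finset.sum_congr rfl fun i _ => (hexp i).symm

/-! ### 4. The Laplacian and `𝔥` commute with orthogonal colour rotations -/

section Laplacian

variable {M : Matrix (Fin 3) (Fin 3) ℝ} {φ : ZM → ℝ}

/-- Chain rule: `D(φ ∘ M·)(x) = Dφ(M·x) ∘ M·`. [cite: ReedSimonIV1978, §XIII.12 Cor. of Thm. XIII.46] -/
theorem fderiv_comp_colourRotate (hφ : Differentiable ℝ φ) (M : Matrix (Fin 3) (Fin 3) ℝ) (x : ZM) :
    fderiv ℝ (fun y => φ (colourRotate M y)) x = (fderiv ℝ φ (colourRotate M x)).comp (colourRotateL M) := by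
  have h : (fun y => φ (colourRotate M y)) = φ ∘ (colourRotateL M) := rfl
  rw [h, fderiv_comp x (hφ _) (colourRotateL M).differentiableAt, ContinuousLinearMap.fderiv]
  rfl

/-- First partials of `φ ∘ M·`: `∂_p(φ ∘ M·)(x) = Dφ(M·x)(M·e_p)`. [cite: ReedSimonIV1978, §XIII.12 Cor. of Thm. XIII.46] -/
theorem pderiv_comp_colourRotate (hφ : Differentiable ℝ φ) (M : Matrix (Fin 3) (Fin 3) ℝ)
    (p : Fin 3 × Fin 3) (x : ZM) :
    pderiv p (fun y => φ (colourRotate M y)) x = fderiv ℝ φ (colourRotate M x) (colourRotate M (unitDir p)) := by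
  rw [pderiv, fderiv_comp_colourRotate hφ M x]
  rfl

/-- Second partials of `φ ∘ M·` (`φ ∈ C²`): `∂_p∂_p(φ ∘ M·)(x) = D²φ(M·x)(M·e_p, M·e_p)`.
[cite: ReedSimonIV1978, §XIII.12 Cor. of Thm. XIII.46] -/
theorem pderiv_pderiv_comp_colourRotate (hφ : ContDiff ℝ 2 φ) (M : Matrix (Fin 3) (Fin 3) ℝ)
    (p : Fin 3 × Fin 3) (x : ZM) :
    pderiv p (pderiv p (fun y => φ (colourRotate M y))) x =
      fderiv ℝ (fderiv ℝ φ) (colourRotate M x) (colourRotate M (unitDir p)) (colourRotate M (unitDir p)) := by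
  have hφd : Differentiable ℝ φ := hφ.differentiable (by norm_num)
  have hDφd : Differentiable ℝ (fderiv ℝ φ) :=
    (hφ.fderiv_right (m := 1) (by norm_num)).differentiable (by norm_num)
  -- the first partial is `g ∘ M·` with `g z = Dφ(z)(M·e_p)`
  have h1 : pderiv p (fun y => φ (colourRotate M y)) =
      fun y => (fun z => fderiv ℝ φ z (colourRotate M (unitDir p))) (colourRotate M y) :=
    funext fun y => pderiv_comp_colourRotate hφd M p y
  have hgd : Differentiable ℝ (fun z => fderiv ℝ φ z (colourRotate M (unitDir p))) :=
    hDφd.clm_apply (differentiable_const _)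
  rw [pderiv, h1, fderiv_comp_colourRotate hgd M x, ContinuousLinearMap.comp_apply, colourRotateL_apply,
    fderiv_clm_apply (hDφd _) (differentiableAt_const _)]
  simp

/-- **The Laplacian commutes with orthogonal colour rotations**: `Δ(φ ∘ M·)(x) = (Δφ)(M·x)` for
`φ ∈ C²(ℝ⁹)` and `M ∈ O(3)` (the Hessian trace is independent of the orthonormal basis
`{M·e_p}`). [cite: ReedSimonIV1978, §XIII.12 Cor. of Thm. XIII.46] -/
theorem laplacian_comp_colourRotate (hM : M ∈ Matrix.orthogonalGroup (Fin 3) ℝ) (hφ : ContDiff ℝ 2 φ)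
    (x : ZM) :
    laplacian (fun y => φ (colourRotate M y)) x = laplacian φ (colourRotate M x) := by
  have hφd : Differentiable ℝ φ := hφ.differentiable (by norm_num)
  have hDφd : Differentiable ℝ (fderiv ℝ φ) :=
    (hφ.fderiv_right (m := 1) (by norm_num)).differentiable (by norm_num)
  rw [laplacian_def, laplacian_def]
  simp only [pderiv_pderiv_comp_colourRotate hφ M]
  -- the plain second partials are the Hessian on the standard basis
  have hstd : ∀ p, pderiv p (pderiv p φ) (colourRotate M x) =
      fderiv ℝ (fderiv ℝ φ) (colourRotate M x) (unitDir p) (unitDir p) := by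
    intro p
    have h1 : pderiv p φ = fun z => fderiv ℝ φ z (unitDir p) := rfl
    rw [pderiv, h1, fderiv_clm_apply (hDφd _) (differentiableAt_const _)]
    simp
  simp only [hstd]
  -- basis independence of the trace of the Hessian
  set β : ZM →L[ℝ] ZM →L[ℝ] ℝ := fderiv ℝ (fderiv ℝ φ) (colourRotate M x) with hβ
  set b : OrthonormalBasis (Fin 3 × Fin 3) ℝ ZM := EuclideanSpace.basisFun (Fin 3 × Fin 3) ℝ with hb
  have hb_apply : ∀ p, b p = unitDir p := fun p => by
    rw [hb, EuclideanSpace.basisFun_apply]; rfl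
  have hb'_apply : ∀ p, (b.map (colourRotateLIE hM)) p = colourRotate M (unitDir p) := fun p => by
    rw [OrthonormalBasis.map_apply, hb_apply, colourRotateLIE_apply]
  have h := sum_bilin_orthonormalBasis_eq β (b.map (colourRotateLIE hM)) b
  simp only [hb'_apply, hb_apply] at h
  exact h

/-- ★ **`𝔥` commutes with orthogonal colour rotations**: `𝔥(φ ∘ M·)(x) = (𝔥φ)(M·x)` for `φ ∈ C²(ℝ⁹)`,
`M ∈ O(3)`. [cite: ReedSimonIV1978, §XIII.12 Cor. of Thm. XIII.46] -/
theorem hApply_comp_colourRotate (hM : M ∈ Matrix.orthogonalGroup (Fin 3) ℝ) (hφ : ContDiff ℝ 2 φ) (x : ZM) :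
    hApply (fun y => φ (colourRotate M y)) x = hApply φ (colourRotate M x) := by
  rw [hApply_def, hApply_def, laplacian_comp_colourRotate hM hφ, luscherPotential_colourRotate hM]

/-- `φ ∘ M·` is `C^n` if `φ` is. [cite: ReedSimonIV1978, §XIII.12 Cor. of Thm. XIII.46] -/
theorem contDiff_comp_colourRotate {n : WithTop ℕ∞} (hφ : ContDiff ℝ n φ) (M : Matrix (Fin 3) (Fin 3) ℝ) :
    ContDiff ℝ n fun y => φ (colourRotate M y) :=
  hφ.comp (colourRotateL M).contDiff

/-- `φ ∘ M·` has compact support if `φ` has and `M ∈ O(3)`. [cite: ReedSimonIV1978, §XIII.12 Cor. of Thm. XIII.46] -/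
theorem hasCompactSupport_comp_colourRotate (hφ : HasCompactSupport φ)
    (hM : M ∈ Matrix.orthogonalGroup (Fin 3) ℝ) :
    HasCompactSupport fun y => φ (colourRotate M y) :=
  hφ.comp_homeomorph (colourRotateLIE hM).toHomeomorph

/-- **The `C²_c` core is stable under orthogonal colour rotations.** [cite: ReedSimonIV1978, §XIII.12 Cor. of Thm. XIII.46] -/
theorem isTestFn_comp_colourRotate (hφ : IsTestFn φ) (hM : M ∈ Matrix.orthogonalGroup (Fin 3) ℝ) :
    IsTestFn fun y => φ (colourRotate M y) :=
  ⟨contDiff_comp_colourRotate hφ.1 M, hasCompactSupport_comp_colourRotate hφ.2 hM⟩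

/-- `SO(3) ⊆ O(3)`: a special orthogonal matrix is orthogonal. [cite: Vanbaal2001, §4] -/
theorem mem_orthogonalGroup_of_mem_specialOrthogonalGroup
    (hM : M ∈ Matrix.specialOrthogonalGroup (Fin 3) ℝ) : M ∈ Matrix.orthogonalGroup (Fin 3) ℝ :=
  hM.1

/-- A colour-rotation invariant function composed with `M·`, `M ∈ SO(3)`, is itself.
[cite: Vanbaal2001, §4] -/
theorem IsGaugeInv.comp_colourRotate_eq (hφ : IsGaugeInv φ) (hM : M ∈ Matrix.specialOrthogonalGroup (Fin 3) ℝ) :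
    (fun y => φ (colourRotate M y)) = φ :=
  funext fun y => hφ M hM y

end Laplacian

end Literature.Analysis.OperatorTheory.YMMatrixModel

end
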